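import Summits.QuantumFields.YangMills.Theorems.IR.EsPolymerGasSwapK

/-!
# Crux `IR` (item stmt-QuantumFields-19354) — line «es-polymer-decoupling», reshaped engine, input (c), part 2/3:
# THE TWO-COPY PEIERLS BOUND OF THE BAD EVENT AND THE LATTICE-ANIMAL TAIL

Helper module for item `stmt-QuantumFields-19354` (`--supports … --as helper`; it closes nothing).  Continues
`Theorems/IR/EsPolymerGasSwapK.lean`.  §3: a bad pair of compatible families (some polymer of the `B`-cluster of `Γ ∪ Γ′` is
near the `A`-block) contains a touching-component from a near-`B` polymer to a near-`A` polymer, whose cells form ONE polymer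
near both blocks (`cells_comp_mem_animals`); the multi-polymer Peierls bound `∑_{Γ ⊇ F} g Γ ≤ ∏_{γ∈F} act γ ≤ p^{#cells F}`
(`sum_filter_subset_le_prod_act`, `prod_act_le_pow_card_cells`) in each copy and the injectivity of `F ↦ cells F` on
compatible families (`eq_of_compatible_of_cells_eq`) give `g⊗g(goodᶜ) ≤ ∑_{X ∈ animals} (4p)^{#X}`
(`pairProbNotMem_good_le`).  §4: the lattice-animal sum over polymers near both blocks is bounded exactly as in
`sum_mass_not_disjoint_nearFamily_le_pow` (`Theorems/IR/EsPolymerPeierlsTailK.lean` §3) with `√p ↦ 2√p`: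
`≤ 2 (2k+3)⁴ (2√p)^{(cellDist c_A c_B − (2k+2))/6 + 2}` once `(13⁴+1)² · 2√p ≤ 1/2` (`sum_animals_pow_le`).

HONEST FRAMING: elementary finite combinatorics for ONE input of an OPEN, PROVABLE engine stub of a CONDITIONAL rung
line; the load of that line, `stub_polymerCertK : IRPolymerCertK` (a disjoint-polymer representation of lattice
Yang–Mills at every large β — the weak-coupling mass gap in polymer clothes), is untouched; nothing here proves
clustering of lattice Yang–Mills, `BalabanLadder.IR`, or the Clay Yang–Mills problem; R4 closes only the conditional
finite-𝕋⁴ rung `BalabanLadder.UV`.  No `Prop`-valued definitions, no Theses conclusion.  Authored by the ideator seat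
ym-ir-idea-1 (g7) as a stub-level service for the lead prover ym-ir-line-mxc-p1 (RULING g9-№2; line verdicts crit-1 /
crit-2 PASS-WITH-PRICE 2026-08-28T00:01Z / 00:04Z: engine allowed, no prover on the load).
-/

set_option autoImplicit false

noncomputable section

open MeasureTheory Finset Function
open Literature.MathematicalPhysics.QuantumFieldTheory
open Literature.MathematicalPhysics.QuantumFieldTheory.AdhikariCao2022 (IsSwappingMap fexpect fcov pairProbNotMem
  norm_fcov_le_of_isSwappingMap)
open Literature.Probability.LatticeModels (IsRConnected sum_pow_card_le_of_connected)

namespace Summit.QuantumFields.YangMills.Cruxes.IR.EsPolymer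

namespace GasMixing

variable {q : ℕ}

/-! ## §3 The two-copy Peierls bound for the bad event -/

/-- **Multi-polymer Peierls bound**: the gas-probability that a family contains all of `F` is at most `∏_{γ∈F} act γ`. -/
theorem sum_filter_subset_le_prod_act {g : Finset (Finset (Cell q)) → ℝ} {act : Finset (Cell q) → ℝ} {Z : ℝ}
    (hg0 : ∀ Γ, 0 ≤ g Γ) (hg1 : ∑ Γ, g Γ = 1) (hgc : ∀ Γ, ¬ Compatible Γ → g Γ = 0)
    (hmass : ∀ Γ, Compatible Γ → g Γ = Z⁻¹ * ∏ γ ∈ Γ, act γ) (hact : ∀ γ, 0 ≤ act γ)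
    (F : Finset (Finset (Cell q))) :
    ∑ Γ ∈ Finset.univ.filter (fun Γ => F ⊆ Γ), g Γ ≤ ∏ γ ∈ F, act γ := by
  classical
  have hfac : ∀ Γ ∈ Finset.univ.filter (fun Γ => F ⊆ Γ), g Γ ≤ (∏ γ ∈ F, act γ) * g (Γ \ F) := by
    intro Γ hΓ
    have hsub : F ⊆ Γ := (mem_filter.1 hΓ).2
    by_cases hc : Compatible Γ
    · rw [hmass Γ hc, hmass (Γ \ F) (compatible_of_subset hc sdiff_subset), ← prod_sdiff hsub]
      exact le_of_eq (by ring)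
    · rw [hgc Γ hc]; exact mul_nonneg (prod_nonneg fun γ _ => hact γ) (hg0 _)
  refine (sum_le_sum hfac).trans ?_
  rw [← mul_sum]
  refine mul_le_of_le_one_right (prod_nonneg fun γ _ => hact γ) ?_
  set S : Finset (Finset (Finset (Cell q))) := Finset.univ.filter (fun Γ => F ⊆ Γ) with hS
  have hinj : Set.InjOn (fun Γ : Finset (Finset (Cell q)) => Γ \ F) (S : Set (Finset (Finset (Cell q)))) := by
    intro Γ₁ h₁ Γ₂ h₂ h
    have hm₁ : F ⊆ Γ₁ := (mem_filter.1 (Finset.mem_coe.1 h₁)).2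
    have hm₂ : F ⊆ Γ₂ := (mem_filter.1 (Finset.mem_coe.1 h₂)).2
    have h' : Γ₁ \ F = Γ₂ \ F := h
    rw [← sdiff_union_of_subset hm₁, ← sdiff_union_of_subset hm₂, h']
  calc ∑ Γ ∈ S, g (Γ \ F)
      = ∑ Γ' ∈ S.image (fun Γ => Γ \ F), g Γ' := (sum_image hinj).symm
    _ ≤ ∑ Γ', g Γ' := sum_le_sum_of_subset_of_nonneg (subset_univ _) fun Γ _ _ => hg0 Γ
    _ = 1 := hg1

/-- `∏_{γ∈F} act γ ≤ p^{#cells F}` for `0 ≤ act γ ≤ p^{#γ}`, `0 ≤ p ≤ 1`. -/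
theorem prod_act_le_pow_card_cells {act : Finset (Cell q) → ℝ} {p : ℝ} (hact : ∀ γ, 0 ≤ act γ)
    (hactp : ∀ γ, act γ ≤ p ^ γ.card) (hp : 0 ≤ p) (hp1 : p ≤ 1) (F : Finset (Finset (Cell q))) :
    ∏ γ ∈ F, act γ ≤ p ^ (cells F).card := by
  classical
  calc ∏ γ ∈ F, act γ ≤ ∏ γ ∈ F, p ^ γ.card := prod_le_prod (fun γ _ => hact γ) fun γ _ => hactp γ
    _ = p ^ (∑ γ ∈ F, γ.card) := prod_pow_eq_pow_sum _ _ _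
    _ ≤ p ^ (cells F).card := pow_le_pow_of_le_one hp hp1 (card_biUnion_le (s := F) (t := id))

/-! ### `cells` is injective on compatible families -/

/-- A polymer contained in the cells of a compatible family lies inside ONE of its members. -/
theorem exists_subset_of_isPolymer_subset_cells {δ : Finset (Cell q)} (hδ : IsPolymer δ)
    {F : Finset (Finset (Cell q))} (hF : Compatible F) (hsub : δ ⊆ cells F) : ∃ δ' ∈ F, δ ⊆ δ' := by
  classical
  obtain ⟨c₀, hc₀⟩ := hδ.1
  have hmem : ∀ c ∈ δ, ∃ δ' ∈ F, c ∈ δ' := fun c hc => by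
    simpa [cells, mem_biUnion] using hsub hc
  obtain ⟨δ', hδ'F, hc₀δ'⟩ := hmem c₀ hc₀
  refine ⟨δ', hδ'F, fun c hc => ?_⟩
  have key : ∀ c, Relation.ReflTransGen (fun x y => x ∈ δ ∧ y ∈ δ ∧ cellDist x y ≤ 6) c₀ c → c ∈ δ' := by
    intro c h
    induction h with
    | refl => exact hc₀δ'
    | @tail x y _ hxy ih =>
      obtain ⟨-, hy, hd⟩ := hxy
      obtain ⟨δ'', hδ''F, hyδ''⟩ := hmem y hy
      by_contra hne'
      have hne : δ' ≠ δ'' := fun h => hne' (h ▸ hyδ'')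
      have := hF.2 δ' hδ'F δ'' hδ''F hne x ih y hyδ''
      omega
  exact key c (hδ.2 c₀ hc₀ c hc)

/-- Two members of a compatible family sharing a cell are equal. -/
theorem eq_of_mem_of_mem {F : Finset (Finset (Cell q))} (hF : Compatible F) {δ δ' : Finset (Cell q)} (hδ : δ ∈ F)
    (hδ' : δ' ∈ F) {c : Cell q} (hc : c ∈ δ) (hc' : c ∈ δ') : δ = δ' := by
  by_contra hne
  have := hF.2 δ hδ δ' hδ' hne c hc c hc'
  rw [cellDist_self] at this
  omega

/-- **`cells` is injective on compatible families.** -/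
theorem eq_of_compatible_of_cells_eq {F F' : Finset (Finset (Cell q))} (hF : Compatible F) (hF' : Compatible F')
    (h : cells F = cells F') : F = F' := by
  suffices key : ∀ {F F' : Finset (Finset (Cell q))}, Compatible F → Compatible F' → cells F = cells F' → F ⊆ F' from
    Subset.antisymm (key hF hF' h) (key hF' hF h.symm)
  intro F F' hF hF' h δ hδ
  have hδP : IsPolymer δ := hF.1 δ hδ
  have hδsub : δ ⊆ cells F' := h ▸ (subset_biUnion_of_mem id hδ : δ ⊆ cells F)
  obtain ⟨δ', hδ', hδδ'⟩ := exists_subset_of_isPolymer_subset_cells hδP hF' hδsub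
  have hδ'sub : δ' ⊆ cells F := h.symm ▸ (subset_biUnion_of_mem id hδ' : δ' ⊆ cells F')
  obtain ⟨δ'', hδ'', hδ'δ''⟩ := exists_subset_of_isPolymer_subset_cells (hF'.1 δ' hδ') hF hδ'sub
  obtain ⟨c₀, hc₀⟩ := hδP.1
  have heq : δ = δ'' := eq_of_mem_of_mem hF hδ hδ'' hc₀ (hδ'δ'' (hδδ' hc₀))
  have hδ'δ : δ' ⊆ δ := heq ▸ hδ'δ''
  have : δ = δ' := Subset.antisymm hδδ' hδ'δ
  exact this ▸ hδ'


/-! ### The contour of a bad pair -/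

/-- **The cells of a touching-component form ONE polymer near both blocks** (when the component contains a polymer near
each block). -/
theorem cells_comp_mem_animals {Δ : Finset (Finset (Cell q))} (hΔ : ∀ δ ∈ Δ, IsPolymer δ) {s : Finset (Cell q)}
    (hs : s ∈ Δ) {cA cB : Cell q} {k : ℕ} (hA : ∃ c' ∈ s, cellDist cA c' ≤ k + 1)
    (hB : ∃ γ₀ ∈ comp Δ s, ∃ c' ∈ γ₀, cellDist cB c' ≤ k + 1) :
    cells (comp Δ s) ∈ animals cA cB k := by
  classical
  set X := cells (comp Δ s) with hX
  have hsX : s ⊆ X := subset_cells (self_mem_comp hs)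
  obtain ⟨c₀, hc₀⟩ := (hΔ s hs).1
  -- every cell of the component is `X`-reachable from `c₀`
  have hmono : ∀ δ ∈ comp Δ s, ∀ a ∈ δ, ∀ b ∈ δ,
      Relation.ReflTransGen (fun x y => x ∈ X ∧ y ∈ X ∧ cellDist x y ≤ 6) a b := by
    intro δ hδ a ha b hb
    have hδX : δ ⊆ X := subset_cells hδ
    exact Relation.ReflTransGen.mono
      (fun x y (h : x ∈ δ ∧ y ∈ δ ∧ cellDist x y ≤ 6) => (⟨hδX h.1, hδX h.2.1, h.2.2⟩ : x ∈ X ∧ y ∈ X ∧ cellDist x y ≤ 6))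
      _ _ ((hΔ δ (comp_subset Δ s hδ)).2 a ha b hb)
  have hreach : ∀ δ, Relation.ReflTransGen
      (fun x y => x ∈ Δ ∧ y ∈ Δ ∧ ∃ c ∈ x, ∃ c' ∈ y, cellDist c c' ≤ 6) s δ →
      ∀ c ∈ δ, Relation.ReflTransGen (fun x y => x ∈ X ∧ y ∈ X ∧ cellDist x y ≤ 6) c₀ c := by
    intro δ h
    induction h with
    | refl => exact fun c hc => hmono s (self_mem_comp hs) c₀ hc₀ c hc
    | @tail x y hsx hxy ih =>
      intro c hc
      obtain ⟨hxΔ, hyΔ, a, ha, b, hb, hab⟩ := hxy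
      have hxC : x ∈ comp Δ s := mem_comp.2 ⟨hxΔ, hsx⟩
      have hyC : y ∈ comp Δ s := mem_comp.2 ⟨hyΔ, hsx.tail ⟨hxΔ, hyΔ, a, ha, b, hb, hab⟩⟩
      exact ((ih a ha).tail ⟨subset_cells hxC ha, subset_cells hyC hb, hab⟩).trans (hmono y hyC b hb c hc)
  have hsymm : ∀ ⦃x y : Cell q⦄, (x ∈ X ∧ y ∈ X ∧ cellDist x y ≤ 6) → (y ∈ X ∧ x ∈ X ∧ cellDist y x ≤ 6) :=
    fun x y ⟨hx, hy, hd⟩ => ⟨hy, hx, by rwa [cellDist_comm]⟩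
  have hpoly : IsPolymer X := by
    refine ⟨⟨c₀, hsX hc₀⟩, fun c hc c' hc' => ?_⟩
    obtain ⟨δ, hδ, hcδ⟩ := mem_cells.1 hc
    obtain ⟨δ', hδ', hcδ'⟩ := mem_cells.1 hc'
    exact (rtg_symm hsymm (hreach δ (mem_comp.1 hδ).2 c hcδ)).trans (hreach δ' (mem_comp.1 hδ').2 c' hcδ')
  refine mem_filter.2 ⟨mem_univ _, hpoly, ?_, ?_⟩
  · obtain ⟨c', hc', hd⟩ := hA
    exact ⟨c', hsX hc', hd⟩
  · obtain ⟨γ₀, hγ₀, c', hc', hd⟩ := hB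
    exact ⟨c', subset_cells hγ₀ hc', hd⟩

open Classical in
/-- **Two-copy Peierls bound**: `g⊗g(goodᶜ) ≤ ∑_{X ∈ animals} (4p)^{#X}`. -/
theorem pairProbNotMem_good_le {g : Finset (Finset (Cell q)) → ℝ} {act : Finset (Cell q) → ℝ} {Z p : ℝ}
    (hg0 : ∀ Γ, 0 ≤ g Γ) (hg1 : ∑ Γ, g Γ = 1) (hgc : ∀ Γ, ¬ Compatible Γ → g Γ = 0)
    (hmass : ∀ Γ, Compatible Γ → g Γ = Z⁻¹ * ∏ γ ∈ Γ, act γ) (hact : ∀ γ, 0 ≤ act γ)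
    (hactp : ∀ γ, act γ ≤ p ^ γ.card) (hp : 0 ≤ p) (hp1 : p ≤ 1) (k : ℕ) (cA cB : Cell q) :
    pairProbNotMem g (good cA cB k) ≤ ∑ X ∈ animals cA cB k, (4 * p) ^ X.card := by
  classical
  set Bad := (good cA cB k)ᶜ.filter
    (fun pr : Finset (Finset (Cell q)) × Finset (Finset (Cell q)) => Compatible pr.1 ∧ Compatible pr.2) with hBad
  -- step 0: incompatible pairs carry no weight
  have h0 : pairProbNotMem g (good cA cB k) = ∑ pr ∈ Bad, g pr.1 * g pr.2 := by
    unfold pairProbNotMem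
    rw [hBad, sum_filter]
    refine sum_congr rfl fun pr _ => ?_
    split_ifs with h
    · rfl
    · by_cases h1 : Compatible pr.1
      · rw [hgc _ (fun h2 => h ⟨h1, h2⟩), mul_zero]
      · rw [hgc _ h1, zero_mul]
  -- the seed: a polymer of the `B`-cluster near the `A`-block
  have hex : ∀ pr ∈ Bad, ∃ s, s ∈ clusterB (pr.1 ∪ pr.2) cB k ∧ ∃ c' ∈ s, cellDist cA c' ≤ k + 1 := by
    intro pr hpr
    have hpr' := (mem_filter.1 hpr).1
    rw [mem_compl] at hpr'
    by_contra hcon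
    refine hpr' (mem_filter.2 ⟨mem_univ _, fun γ hγ c' hc' => not_le.1 fun hle => hcon ⟨γ, hγ, c', hc', hle⟩⟩)
  choose! seed hseed using hex
  -- the witness pair of sub-families and its cell set
  set W : Finset (Finset (Cell q)) × Finset (Finset (Cell q)) → Finset (Finset (Cell q)) × Finset (Finset (Cell q)) :=
    fun pr => (pr.1 ∩ comp (pr.1 ∪ pr.2) (seed pr), pr.2 ∩ comp (pr.1 ∪ pr.2) (seed pr)) with hW
  set Xc : Finset (Finset (Cell q)) × Finset (Finset (Cell q)) → Finset (Cell q) :=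
    fun w => cells w.1 ∪ cells w.2 with hXc
  have hWX : ∀ pr, Xc (W pr) = cells (comp (pr.1 ∪ pr.2) (seed pr)) := by
    intro pr
    simp only [hXc, hW, ← cells_union, ← union_inter_distrib_right]
    rw [inter_eq_right.2 (comp_subset _ _)]
  have hXanimal : ∀ pr ∈ Bad, Xc (W pr) ∈ animals cA cB k := by
    intro pr hpr
    obtain ⟨hc1, hc2⟩ := (mem_filter.1 hpr).2
    obtain ⟨hsK, hsA⟩ := hseed pr hpr
    obtain ⟨hsΔ, γ₀, hγ₀Δ, hγ₀B, hγ₀s⟩ := mem_filter.1 hsK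
    rw [hWX]
    refine cells_comp_mem_animals (fun δ hδ => ?_) hsΔ hsA ⟨γ₀, mem_comp.2 ⟨hγ₀Δ, ?_⟩, hγ₀B⟩
    · rcases mem_union.1 hδ with h | h
      · exact hc1.1 δ h
      · exact hc2.1 δ h
    · exact rtg_symm (touch_symmetric _) hγ₀s
  have hWcompat : ∀ pr ∈ Bad, Compatible (W pr).1 ∧ Compatible (W pr).2 := by
    intro pr hpr
    obtain ⟨hc1, hc2⟩ := (mem_filter.1 hpr).2
    exact ⟨compatible_of_subset hc1 inter_subset_left, compatible_of_subset hc2 inter_subset_left⟩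
  -- step 1: fibres of `W`
  have h1 : ∑ pr ∈ Bad, g pr.1 * g pr.2 =
      ∑ w ∈ Bad.image W, ∑ pr ∈ Bad.filter (fun pr => W pr = w), g pr.1 * g pr.2 :=
    (sum_fiberwise_of_maps_to (fun pr hpr => mem_image_of_mem W hpr) _).symm
  -- step 2: the fibre over `w = (F₁, F₂)` is bounded by two Peierls factors
  have h2 : ∀ w ∈ Bad.image W, ∑ pr ∈ Bad.filter (fun pr => W pr = w), g pr.1 * g pr.2 ≤ p ^ (Xc w).card := by
    intro w hw
    have hsub : Bad.filter (fun pr => W pr = w) ⊆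
        (Finset.univ.filter fun Γ => w.1 ⊆ Γ) ×ˢ (Finset.univ.filter fun Γ => w.2 ⊆ Γ) := by
      intro pr hpr
      obtain ⟨-, hprw⟩ := mem_filter.1 hpr
      rw [← hprw]
      exact mem_product.2 ⟨mem_filter.2 ⟨mem_univ _, inter_subset_left⟩, mem_filter.2 ⟨mem_univ _, inter_subset_left⟩⟩
    calc ∑ pr ∈ Bad.filter (fun pr => W pr = w), g pr.1 * g pr.2
        ≤ ∑ pr ∈ (Finset.univ.filter fun Γ => w.1 ⊆ Γ) ×ˢ (Finset.univ.filter fun Γ => w.2 ⊆ Γ),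
            g pr.1 * g pr.2 :=
          sum_le_sum_of_subset_of_nonneg hsub fun pr _ _ => mul_nonneg (hg0 _) (hg0 _)
      _ = (∑ Γ ∈ Finset.univ.filter (fun Γ => w.1 ⊆ Γ), g Γ) *
            ∑ Γ ∈ Finset.univ.filter (fun Γ => w.2 ⊆ Γ), g Γ := by
          rw [sum_product, sum_mul_sum]
      _ ≤ (∏ γ ∈ w.1, act γ) * ∏ γ ∈ w.2, act γ :=
          mul_le_mul (sum_filter_subset_le_prod_act hg0 hg1 hgc hmass hact w.1)
            (sum_filter_subset_le_prod_act hg0 hg1 hgc hmass hact w.2)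
            (sum_nonneg fun Γ _ => hg0 Γ) (prod_nonneg fun γ _ => hact γ)
      _ ≤ p ^ (cells w.1).card * p ^ (cells w.2).card :=
          mul_le_mul (prod_act_le_pow_card_cells hact hactp hp hp1 w.1)
            (prod_act_le_pow_card_cells hact hactp hp hp1 w.2) (prod_nonneg fun γ _ => hact γ) (pow_nonneg hp _)
      _ = p ^ ((cells w.1).card + (cells w.2).card) := (pow_add _ _ _).symm
      _ ≤ p ^ (Xc w).card := pow_le_pow_of_le_one hp hp1 (card_union_le _ _)
  -- step 3: regroup the witnesses by their cell set, an animal; at most `4^{#X}` witnesses per animal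
  have h3 : ∑ w ∈ Bad.image W, p ^ (Xc w).card =
      ∑ X ∈ animals cA cB k, ∑ w ∈ (Bad.image W).filter (fun w => Xc w = X), p ^ (Xc w).card := by
    refine (sum_fiberwise_of_maps_to (fun w hw => ?_) _).symm
    obtain ⟨pr, hpr, rfl⟩ := mem_image.1 hw
    exact hXanimal pr hpr
  have h4 : ∀ X ∈ animals cA cB k,
      ∑ w ∈ (Bad.image W).filter (fun w => Xc w = X), p ^ (Xc w).card ≤ (4 * p) ^ X.card := by
    intro X hX
    set S := (Bad.image W).filter (fun w => Xc w = X) with hS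
    have hconst : ∑ w ∈ S, p ^ (Xc w).card = S.card * p ^ X.card := by
      rw [sum_congr rfl fun w hw => by rw [(mem_filter.1 hw).2], sum_const, nsmul_eq_mul]
    rw [hconst]
    have hcard : (S.card : ℝ) ≤ 4 ^ X.card := by
      have hc := card_le_card_of_injOn (s := S) (t := X.powerset ×ˢ X.powerset)
        (fun w => (cells w.1, cells w.2)) (fun w hw => ?_) (fun w hw w' hw' hww' => ?_)
      · rw [card_product, card_powerset] at hc
        calc (S.card : ℝ) ≤ ((2 ^ X.card * 2 ^ X.card : ℕ) : ℝ) := by exact_mod_cast hc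
          _ = 4 ^ X.card := by push_cast; rw [← mul_pow]; norm_num
      · have hwX : Xc w = X := (mem_filter.1 (mem_coe.1 hw)).2
        rw [mem_coe, mem_product, mem_powerset, mem_powerset, ← hwX]
        exact ⟨subset_union_left, subset_union_right⟩
      · obtain ⟨pr, hpr, hprw⟩ := mem_image.1 (mem_filter.1 (mem_coe.1 hw)).1
        obtain ⟨pr', hpr', hprw'⟩ := mem_image.1 (mem_filter.1 (mem_coe.1 hw')).1
        have hcw := hWcompat pr hpr
        have hcw' := hWcompat pr' hpr'
        rw [hprw] at hcw
        rw [hprw'] at hcw'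
        obtain ⟨h₁, h₂⟩ := Prod.mk.inj hww'
        exact Prod.ext (eq_of_compatible_of_cells_eq hcw.1 hcw'.1 h₁) (eq_of_compatible_of_cells_eq hcw.2 hcw'.2 h₂)
    calc (S.card : ℝ) * p ^ X.card ≤ 4 ^ X.card * p ^ X.card := mul_le_mul_of_nonneg_right hcard (pow_nonneg hp _)
      _ = (4 * p) ^ X.card := (mul_pow _ _ _).symm
  -- assembly
  rw [h0, h1]
  calc ∑ w ∈ Bad.image W, ∑ pr ∈ Bad.filter (fun pr => W pr = w), g pr.1 * g pr.2
      ≤ ∑ w ∈ Bad.image W, p ^ (Xc w).card := sum_le_sum h2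
    _ = _ := h3
    _ ≤ _ := sum_le_sum h4

/-! ## §4 The lattice-animal tail -/

open Classical in
/-- **The lattice-animal tail** (the pattern of `sum_mass_not_disjoint_nearFamily_le_pow` §3 with `t = 2√p`, `t² = 4p`). -/
theorem sum_animals_pow_le [NeZero q] {p : ℝ} (hp : 0 ≤ p)
    (hsmall : ((13 : ℝ) ^ 4 + 1) ^ 2 * (2 * Real.sqrt p) ≤ 1 / 2) (k : ℕ) (cA cB : Cell q) :
    ∑ X ∈ animals cA cB k, (4 * p) ^ X.card ≤
      2 * ((2 * k + 3 : ℕ) : ℝ) ^ 4 * (2 * Real.sqrt p) ^ ((cellDist cA cB - (2 * k + 2)) / 6 + 2) := by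
  set t : ℝ := 2 * Real.sqrt p with ht
  have hs0 : 0 ≤ Real.sqrt p := Real.sqrt_nonneg p
  have ht0 : 0 ≤ t := by positivity
  have ht1 : t ≤ 1 := by nlinarith [hsmall, ht0]
  have htp : t ^ 2 = 4 * p := by rw [ht, mul_pow, Real.sq_sqrt hp]; norm_num
  set e : ℕ := (cellDist cA cB - (2 * k + 2)) / 6 with he
  set D' : Finset (Finset (Cell q)) := animals cA cB k with hD'
  -- step 1: size of a doubly-near polymer, `(4p)^{#X} ≤ t^{e+1} t^{#X}`
  have h2 : ∀ X ∈ D', (4 * p) ^ X.card ≤ t ^ (e + 1) * t ^ X.card := by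
    intro X hX
    obtain ⟨-, hXP, ⟨c₁, h₁, h₁d⟩, ⟨c₂, h₂, h₂d⟩⟩ := mem_filter.1 hX
    have hcard : e + 1 ≤ X.card := card_ge_of_isPolymer_near_both hXP h₁ h₁d h₂ h₂d
    rw [← htp, ← pow_mul, ← pow_add]
    exact pow_le_pow_of_le_one ht0 ht1 (by omega)
  -- step 2: every doubly-near polymer contains a cell of the ball of radius `k+1` about `c_A`; animal bound there
  set ball : Finset (Cell q) := Finset.univ.filter fun c' : Cell q => cellDist cA c' ≤ k + 1 with hball
  have h3 : ∑ X ∈ D', t ^ X.card ≤ ∑ c₁ ∈ ball, ∑ X ∈ D'.filter (fun X => c₁ ∈ X), t ^ X.card := by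
    have hR : ∑ c₁ ∈ ball, ∑ X ∈ D'.filter (fun X => c₁ ∈ X), t ^ X.card =
        ∑ X ∈ D', ∑ c₁ ∈ ball, if c₁ ∈ X then t ^ X.card else 0 := by
      simp_rw [sum_filter]; rw [sum_comm]
    rw [hR]
    refine sum_le_sum fun X hX => ?_
    obtain ⟨-, -, ⟨c₁, h₁, h₁d⟩, -⟩ := mem_filter.1 hX
    have hc₁ : c₁ ∈ ball := mem_filter.2 ⟨mem_univ _, h₁d⟩
    have h0 : ∀ c ∈ ball, 0 ≤ (if c ∈ X then t ^ X.card else 0) := fun c _ => by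
      split_ifs
      · exact pow_nonneg ht0 _
      · exact le_rfl
    calc t ^ X.card = if c₁ ∈ X then t ^ X.card else 0 := by rw [if_pos h₁]
      _ ≤ _ := single_le_sum (f := fun c => if c ∈ X then t ^ X.card else 0) h0 hc₁
  have h4 : ∀ c₁ : Cell q, ∑ X ∈ D'.filter (fun X => c₁ ∈ X), t ^ X.card ≤ 2 * t := by
    intro c₁
    refine sum_pow_card_le_of_connected (R := fun x y : Cell q => cellDist x y ≤ 6)
      (nbr := fun x => Finset.univ.filter fun y : Cell q => cellDist x y ≤ 6) (Δ := 13 ^ 4)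
      (fun x y h => by rwa [cellDist_comm]) (fun x => ?_) (fun x y h => mem_filter.2 ⟨mem_univ _, h⟩) ht0 ?_ c₁ _
      fun X hX => ?_
    · exact (card_filter_cellDist_le x 6).trans (by norm_num)
    · push_cast; linarith [hsmall]
    · obtain ⟨hXD', hc₁⟩ := mem_filter.1 hX
      have hP : IsPolymer X := (mem_filter.1 hXD').2.1
      exact ⟨hc₁, hP.1, fun c hc c' hc' => Relation.ReflTransGen.mono
        (fun x y (h : x ∈ X ∧ y ∈ X ∧ cellDist x y ≤ 6) => (⟨h.2.2, h.1, h.2.1⟩ : cellDist x y ≤ 6 ∧ x ∈ X ∧ y ∈ X))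
        _ _ (hP.2 c hc c' hc')⟩
  have hballcard : (ball.card : ℝ) ≤ ((2 * k + 3 : ℕ) : ℝ) ^ 4 := by
    have := card_filter_cellDist_le cA (k + 1)
    have h' : 2 * (k + 1) + 1 = 2 * k + 3 := by ring
    rw [h'] at this
    exact_mod_cast this
  -- assembly
  calc ∑ X ∈ D', (4 * p) ^ X.card
      ≤ ∑ X ∈ D', t ^ (e + 1) * t ^ X.card := sum_le_sum h2
    _ = t ^ (e + 1) * ∑ X ∈ D', t ^ X.card := by rw [mul_sum]
    _ ≤ t ^ (e + 1) * ∑ c₁ ∈ ball, ∑ X ∈ D'.filter (fun X => c₁ ∈ X), t ^ X.card :=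
        mul_le_mul_of_nonneg_left h3 (pow_nonneg ht0 _)
    _ ≤ t ^ (e + 1) * ∑ _c₁ ∈ ball, 2 * t := mul_le_mul_of_nonneg_left (sum_le_sum fun c₁ _ => h4 c₁) (pow_nonneg ht0 _)
    _ = t ^ (e + 1) * (ball.card * (2 * t)) := by rw [sum_const, nsmul_eq_mul]
    _ ≤ t ^ (e + 1) * (((2 * k + 3 : ℕ) : ℝ) ^ 4 * (2 * t)) :=
        mul_le_mul_of_nonneg_left (mul_le_mul_of_nonneg_right hballcard (by positivity)) (pow_nonneg ht0 _)
    _ = 2 * ((2 * k + 3 : ℕ) : ℝ) ^ 4 * t ^ (e + 2) := by ring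

end GasMixing

end Summit.QuantumFields.YangMills.Cruxes.IR.EsPolymer

end
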